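import Mathlib.Analysis.SpecialFunctions.Pow.Real
import Summits.ABC.IUTFork.Repair.RHToptKnapsackWorkedPlace
import HarnessLib

/-!
# R-H ROUND 3, AXIS D2 (D-0127 / D-0130) — THE HEIGHT-SCALING BARRIER: «objects whose certified mass grows sub-linearly in the
# height cannot close the requirement `T(h) = M(h) − tol ∝ h` at any height `h ≥ h₀`», with an EXPLICIT `h₀`, the conductor-type
# (exponent `−1`) case of record in closed form, and the worked place FREY `p = 7`, `l = 107` as SATISFIABILITY WITNESS

abc-iut cell, rung LADDER-ABC:A2.RESCUE.H, round-3 AXIS D2 «HEIGHT SCALING» (21-frontier 2026-08-27T11:38:40Z (D2)(a) «BARRIER THEOREM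
candidate: every combination of objects of classes X has exponent < 0 ⇒ cannot close Cor 3.12 at any height ≥ h₀ — type it in Lean as a
Prop with the bed as satisfiability witness, aim to prove»; D-0130 fan-out 11:44:07Z; KEY `wake/KEY-abc-iut-rh2-w-2-D2-TYPE-BARRIER.md`
(priority8 12:14:07Z); desk file `plan/rescue/R-H/ROUND3/AXIS-CD-DESK.md` §D2 (abc-iut-rh-lead g4 12:18Z)). Seat abc-iut-rh2-w-2 = AXIS-D2
TYPER 1 of 2 (BARRIER); typer 2 of 2 abc-iut-rh2-T-1 fixes the shared vocabulary (`Repair/RHHeightScaling.lean`: the height DILATION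
`m_q ↦ s·m_q` of the typed cell currency at fixed places and `l`, `recoveredFraction`, `ExponentAtMost f α C` := «`f(s) ≤ C·s^α` for `s ≥ 1`»,
the six object-class tags, `Door`); the six per-class exponents are the D2-EXP-1…6 seats' (slice · SRM · within-place financing · partial
credit · across-place netting · κ′ laws). THIS FILE is the COMPOSITION: it does not derive any class's exponent — it proves what follows
once they are below `1` in mass (below `0` in recovered fraction), with the threshold height in closed form, and shows on kernel numerals
of the bed that the antecedent is inhabited.

THE CURRENCY (D0121-FINAL-1200Z c9ab8e0bbc43dc94 item (1)(d)/(e); MIN-SLICE v1.9d §(i)/(ii)). Along the height ray of a datum (places and `l`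
fixed, local heights `m_q(w) ↦ s·m_q(w)`, `s ≥ 1`; log-height `h = s·h(1)`): the REQUIREMENT is `T(s) = M(s) − tol` with `M(s) = M₁·s` EXACTLY
(every cell's trivial cost is `(j²−1)·m_q·c(w,j)`, linear in `m_q`: abc-iut-rh2-T-1 `RH.SigmaMass.totalTrivialMass`, abc-iut-rh2-w-1
`RH.CellWeights` «`M = (κ−1)·|−log q|`») and `tol` height-free (`Tol♯(P,l)`, abc-iut-rh2-q2-cond p471097); an OBJECT is anything that
certifies mass toward `T` (licence on a slice, slope-recoverable mass, within-place financing `C_σ`, partial credit, across-place netting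
credit `C`, …); its MASS LAW is a bound `f(s) ≤ C·s^α` from some `s₁` on — mass exponent `α`, i.e. RECOVERED-FRACTION exponent
`e = α − 1` in the desk's `f_X(h) := mass/T(h)`; FINAL (1)(d): every certified credit of record is CONDUCTOR-TYPE (`α = 0`, `e = −1`;
p491053 `RHCreditShellBudget.cellCredit_diag_le_shellBudget`, p495112 `…Setting`, p495856 `…Datum`; fitted `C/R` exponents
`−0.9994 / −1.0001 / −0.9991` on FREY133 / HEX79 / FREY482). «CLOSING at `s`» = the objects together supply the requirement:
`T(s) ≤ Σ_X f_X(s)` — the shape of the typed Cor 3.12 reading of record «`Statement ⟺ R ≤ C`» (abc-iut-rh2-q2-eq p480491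
`RH.SigmaSignedRemainder.statement_iff_signedRemainder_nonpos`) and of «`T ≤ mass(σ)`» (p477034 `RH.SigmaMass.massThreshold_le_onTrivialMass_iff`),
with the height made explicit; the junction with a typed dilation family is the socket `not_holds_from_barrier` (§2), to be instantiated on
abc-iut-rh2-T-1's `RHHeightScaling` dilation BY NAME in a sequel (no setting is re-typed here).

WHAT IS TYPED AND PROVED (all elementary real analysis / integer arithmetic; 0 `sorry`; axioms standard):
* §1 VOCABULARY (barrier side): `PowerBoundFrom f α C s₁` (= rh2-T-1's `ExponentAtMost f α C` at `s₁ = 1`), `requirement M₁ tol s := M₁·s − tol`,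
  `suppliedMass f s := Σ_i f i s`, `ClosedBy f M₁ tol s := requirement ≤ suppliedMass`, `recoveredFraction`, `NeverClosedFrom f M₁ tol s₀`,
  and the claim-tagged Prop **`Barrier`**: «for every finite family of objects with mass exponents `α_i ≤ a < 1` (fraction exponents
  `< 0`) against a requirement of positive slope `M₁`, there is `s₀` with NO closing at any `s ≥ s₀`». `closedBy_mono` (a sub-combination closes
  only if the full family does — so «every combination of classes X» is settled by the union family).
* §2 THE BARRIER IS A THEOREM, threshold in closed form: **`barrierScale M₁ tol s₁ a A := max(s₁, 1, 2·tol/M₁, (2A/M₁)^{1/(1−a)}) + 1`**,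
  `A := Σ_i max(C_i, 0)`; **`suppliedMass_lt_requirement_of_barrierScale_le`** (`∀ s ≥ barrierScale, Σ f_i(s) < M₁·s − tol`),
  **`barrier_holds : Barrier`**. CONDUCTOR-TYPE case of record (`α = 0`) SHARP: **`not_closedBy_of_heightFree`**
  (`Σ f_i ≤ Σ C_i` height-free ⇒ no closing at any `s > (Σ C_i + tol)/M₁` — the crossing law «`s× = (C + tol)/M₁`» of FINAL (1)(e) as an
  inequality), **`recoveredFraction_le_of_heightFree`** (`f_X ≤ (2A/M₁)·s⁻¹` once `2·tol ≤ M₁·s`: exponent `−1`, constant `2A/M₁`); the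
  content-free regime `closedBy_of_requirement_nonpos` (`T(s) ≤ 0` ⇒ every family closes — the tabulated heights, `T < 0` on 781/781);
  socket **`not_holds_from_barrier`** (any height-indexed Prop `Φ s` implying `requirement ≤ supplied` fails from `barrierScale` on).
* §2b BRIDGE to abc-iut-rh2-T-1's fraction currency: `powerBoundFrom_mass_of_fraction` (fraction profile `g ≤ C·s^α` on `s ≥ 1`, i.e. `ExponentAtMost g α C`,
  ⇒ mass law with exponent `α + 1`), **`neverClosedFrom_of_fractionExponents_lt_zero`** («every class has fraction exponent `≤ a < 0`» ⇒ no closing from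
  `barrierScale M₁ tol 1 (a+1) (Σ max(C_i·M₁,0))` on) — the desk's sentence verbatim, hypotheses in T-1's shape (unfolded, so no import is needed).
* §3 SATISFIABILITY WITNESS ON THE BED — the worked place FREY `p = 7`, `l = 107` (abc-iut-topt-pv-2 p490925 `RHToptKnapsackWorkedPlace`:
  `e = 1605`, `m_q = 210`, `δ = 1604`, `r_in = 268`, `r_out = −4472`, `l⋆ = 53`, integer cell currency) DILATED `m_q ↦ 210·s`, `s : ℤ`:
  `frey7_l107_mass_dilate` (`M(s) = 10 707 060·s` — cites `frey7_l107_totalMass` BY NAME), **`frey7_l107_price_dilate_le`** (the exact price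
  `price_j(s) = j·1604 + (j+1)·4740 + ((j²·210·s − j·1604 − (j+1)·268) mod 1605)` depends on `s` only through the residue, so
  `Π(s) ≤ 9 414 496` at EVERY `s` — conductor-type in kernel), **`frey7_l107_price_lt_mass_dilate`** (`Π(s) < M(s)` for every `s ≥ 1`: at this place
  the EX/across-netting envelope `min(M, Π)` (pv-2 `kept_le_surplusValue`) never closes the tol-free requirement, fraction `≤ 0.8793/s`), and
  **`barrier_antecedent_inhabited`**: the hypotheses of `Barrier` hold for the one-object family «netting envelope of the
  worked place» with `M₁ = 10 707 060`, `tol = 0`, `α = 0`, `C = 9 414 496`, `s₁ = 1` — the barrier is NOT vacuous, and its conclusion there is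
  `¬ ClosedBy` from `s = 1` on (`frey7_l107_envelope_neverClosed`).
DELIBERATELY NOT HERE: the per-class laws (D2-EXP seats), the typed dilation of a `Cor312.Setting` and `Door` (abc-iut-rh2-T-1), datum-level
(across-places) crossings `s×` 1.82 / 3.83 / 2.00 (FINAL (1)(e), numerics of record), any abc endpoint.
HONEST FRAMING: real analysis and integer arithmetic about OUR typed cell currency and the listed kernel numerals; «cannot close» is a statement
about the certified OBJECT CLASSES fed into the hypotheses, not about [IUTchIII] Cor. 3.12 in print; nothing here asserts that abc is proved or
refuted, or that Cor. 3.12 / [IUTchIV] Thm. 1.10 holds or fails at any datum, or takes a side on any author; the barrier Prop is a claim-tagged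
HYPOTHESIS SHAPE whose instances are as good as the class laws plugged in; typed ≠ proved for those; computed ≠ proved for the bed link.
[folklore] for the analysis; [claim: Mochizuki2012, status: disputed] for every IUT locution in the docstrings.
-/

noncomputable section

open Finset Real

namespace Summit.ABC.IUTFork.Repair.RH.HeightScalingBarrier

/-! ## §1. Vocabulary: mass laws along the height ray, the requirement, closing, the barrier Prop -/

/-- **Mass law of an object along the height ray**: `PowerBoundFrom f α C s₁` := «`f(s) ≤ C·s^α` for every dilation `s ≥ s₁`» — mass exponent
`α`, constant `C`, onset `s₁` (abc-iut-rh2-T-1's `ExponentAtMost f α C` is the case `s₁ = 1`; the desk's recovered-fraction exponent is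
`e = α − 1`). [folklore] -/
def PowerBoundFrom (f : ℝ → ℝ) (α C s₁ : ℝ) : Prop :=
  ∀ s : ℝ, s₁ ≤ s → f s ≤ C * s ^ α

/-- **The requirement along the height ray**: `T(s) = M₁·s − tol` — total trivial mass `M(s) = M₁·s` (linear in the local heights, MIN-SLICE (i))
minus the height-free tolerance (MIN-SLICE (ii); `RH.SigmaMass.massThreshold`). [claim: Mochizuki2012, status: disputed] -/
def requirement (M₁ tol s : ℝ) : ℝ :=
  M₁ * s - tol

/-- **Mass supplied by a finite family of objects** at dilation `s`: `Σ_i f i s`. [folklore] -/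
def suppliedMass {k : ℕ} (f : Fin k → ℝ → ℝ) (s : ℝ) : ℝ :=
  ∑ i, f i s

/-- **«The family closes the requirement at dilation `s`»**: `T(s) ≤ Σ_i f_i(s)` — the shape of «`T ≤ mass(σ)`» (p477034
`massThreshold_le_onTrivialMass_iff`) and of the Cor 3.12 reading of record «`Statement ⟺ R ≤ C`» (p480491 `statement_iff_signedRemainder_nonpos`)
with the height explicit. [claim: Mochizuki2012, status: disputed] -/
def ClosedBy {k : ℕ} (f : Fin k → ℝ → ℝ) (M₁ tol s : ℝ) : Prop :=
  requirement M₁ tol s ≤ suppliedMass f s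

/-- **Recovered fraction** of the family at dilation `s`: supplied mass over the requirement (the desk's `Σ_X f_X(h)`, AXIS-CD-DESK §D2).
[claim: Mochizuki2012, status: disputed] -/
def recoveredFraction {k : ℕ} (f : Fin k → ℝ → ℝ) (M₁ tol s : ℝ) : ℝ :=
  suppliedMass f s / requirement M₁ tol s

/-- **«Never closed from `s₀` on»**: at no dilation `s ≥ s₀` does the family close the requirement. [claim: Mochizuki2012, status: disputed] -/
def NeverClosedFrom {k : ℕ} (f : Fin k → ℝ → ℝ) (M₁ tol s₀ : ℝ) : Prop :=
  ∀ s : ℝ, s₀ ≤ s → ¬ ClosedBy f M₁ tol s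

/-- **THE HEIGHT-SCALING BARRIER** (R-H round-3 AXIS D2, claim-tagged statement SHAPE — a hypothesis frame, not a fact about print): for every
finite family of objects whose mass laws have exponents `α_i ≤ a < 1` (recovered-fraction exponents `α_i − 1 < 0`) from a common onset `s₁`,
against a requirement of positive slope `M₁` and any height-free tolerance, there is a dilation `s₀` from which on the family NEVER closes the
requirement — «objects of classes with exponent `< 0` cannot close the typed Cor 3.12 reading at any height `≥ h₀ = s₀·h(1)`».
Proved below (`barrier_holds`) with `s₀ = barrierScale …` explicit. [claim: Mochizuki2012, status: disputed] -/
@[claim "Mochizuki2012" "disputed"]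
def Barrier : Prop :=
  ∀ (k : ℕ) (f : Fin k → ℝ → ℝ) (α C : Fin k → ℝ) (s₁ a M₁ tol : ℝ),
    0 < M₁ → a < 1 → (∀ i, α i ≤ a) → (∀ i, PowerBoundFrom (f i) (α i) (C i) s₁) →
      ∃ s₀ : ℝ, NeverClosedFrom f M₁ tol s₀

variable {k : ℕ}

/-- Unfolding `ClosedBy`. [folklore] -/
theorem closedBy_iff (f : Fin k → ℝ → ℝ) (M₁ tol s : ℝ) :
    ClosedBy f M₁ tol s ↔ M₁ * s - tol ≤ ∑ i, f i s :=
  Iff.rfl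

/-- **Monotonicity in the family**: if family `g` supplies at least what `f` supplies at `s`, then `f` closes only if `g` closes — so a bound for the
UNION of all objects of the classes settles every sub-combination. [folklore] -/
theorem closedBy_mono {f g : Fin k → ℝ → ℝ} {M₁ tol s : ℝ} (hfg : suppliedMass f s ≤ suppliedMass g s)
    (h : ClosedBy f M₁ tol s) : ClosedBy g M₁ tol s :=
  le_trans h hfg

/-- Pointwise domination of the objects gives domination of the supplied mass. [folklore] -/
theorem suppliedMass_mono {f g : Fin k → ℝ → ℝ} {s : ℝ} (hfg : ∀ i, f i s ≤ g i s) :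
    suppliedMass f s ≤ suppliedMass g s :=
  Finset.sum_le_sum fun i _ => hfg i

/-- **Content-free regime**: where the requirement is `≤ 0` (the tabulated heights: `T = M − Tol < 0` on 781/781 datum-sides, FINAL (1)(d)) every
family of non-negative objects closes it. [folklore] -/
theorem closedBy_of_requirement_nonpos {f : Fin k → ℝ → ℝ} {M₁ tol s : ℝ} (hT : requirement M₁ tol s ≤ 0)
    (hf : ∀ i, 0 ≤ f i s) : ClosedBy f M₁ tol s :=
  le_trans hT (Finset.sum_nonneg fun i _ => hf i)

/-! ## §2. The barrier is a theorem: explicit threshold, the conductor-type case, the fraction reading, the socket -/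

/-- **The positive-part constant of a family**: `A := Σ_i max(C_i, 0)`. [folklore] -/
def posConstSum (C : Fin k → ℝ) : ℝ :=
  ∑ i, max (C i) 0

/-- `A ≥ 0`. [folklore] -/
theorem posConstSum_nonneg (C : Fin k → ℝ) : 0 ≤ posConstSum C :=
  Finset.sum_nonneg fun _ _ => le_max_right _ _

/-- **THE THRESHOLD DILATION in closed form**: `barrierScale M₁ tol s₁ a A := max (max s₁ 1) (max (2·tol/M₁) ((2A/M₁)^{1/(1−a)})) + 1`. Beyond it:
the onset has passed, `s ≥ 1`, the tolerance is at most half the mass (`tol < M₁·s/2`), and `A·s^a < M₁·s/2`. [folklore] -/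
def barrierScale (M₁ tol s₁ a A : ℝ) : ℝ :=
  max (max s₁ 1) (max (2 * tol / M₁) ((2 * A / M₁) ^ (1 / (1 - a)))) + 1

/-- The four facts packed into `barrierScale ≤ s`. [folklore] -/
theorem barrierScale_le_iff_aux {M₁ tol s₁ a A s : ℝ} (hs : barrierScale M₁ tol s₁ a A ≤ s) :
    s₁ < s ∧ 1 < s ∧ 2 * tol / M₁ < s ∧ (2 * A / M₁) ^ (1 / (1 - a)) < s := by
  unfold barrierScale at hs
  have h1 : max (max s₁ 1) (max (2 * tol / M₁) ((2 * A / M₁) ^ (1 / (1 - a)))) < s := by linarith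
  simp only [max_lt_iff] at h1
  exact ⟨h1.1.1, h1.1.2, h1.2.1, h1.2.2⟩

/-- **Uniform power envelope**: from the onset on and for `s ≥ 1`, a family with exponents `α_i ≤ a` supplies at most `A·s^a`. [folklore] -/
theorem suppliedMass_le_posConstSum_mul_rpow {f : Fin k → ℝ → ℝ} {α C : Fin k → ℝ} {s₁ a s : ℝ}
    (hf : ∀ i, PowerBoundFrom (f i) (α i) (C i) s₁) (hα : ∀ i, α i ≤ a) (hs₁ : s₁ ≤ s) (h1 : 1 ≤ s) :
    suppliedMass f s ≤ posConstSum C * s ^ a := by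
  unfold suppliedMass posConstSum
  rw [Finset.sum_mul]
  refine Finset.sum_le_sum fun i _ => ?_
  have hs0 : 0 ≤ s := le_trans zero_le_one h1
  have hpow_nonneg : 0 ≤ s ^ α i := Real.rpow_nonneg hs0 _
  have hpow_le : s ^ α i ≤ s ^ a := Real.rpow_le_rpow_of_exponent_le h1 (hα i)
  calc f i s ≤ C i * s ^ α i := hf i s hs₁
    _ ≤ max (C i) 0 * s ^ α i := mul_le_mul_of_nonneg_right (le_max_left _ _) hpow_nonneg
    _ ≤ max (C i) 0 * s ^ a := mul_le_mul_of_nonneg_left hpow_le (le_max_right _ _)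

/-- Key analytic step: for `s > (2A/M₁)^{1/(1−a)}`, `s ≥ 1`, `a < 1`, `A ≥ 0`, `M₁ > 0`: `A·s^a < M₁·s/2`. [folklore] -/
theorem posConst_mul_rpow_lt_half {A M₁ a s : ℝ} (hA : 0 ≤ A) (hM : 0 < M₁) (ha : a < 1) (h1 : 1 ≤ s)
    (hs : (2 * A / M₁) ^ (1 / (1 - a)) < s) : A * s ^ a < M₁ * s / 2 := by
  have hs0 : 0 < s := lt_of_lt_of_le zero_lt_one h1
  have h1a : 0 < 1 - a := by linarith
  have hB : 0 ≤ 2 * A / M₁ := by positivity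
  -- `2A/M₁ < s^{1−a}`
  have hlt : 2 * A / M₁ < s ^ (1 - a) := by
    have hmono : ((2 * A / M₁) ^ (1 / (1 - a))) ^ (1 - a) < s ^ (1 - a) :=
      Real.rpow_lt_rpow (Real.rpow_nonneg hB _) hs h1a
    rwa [one_div, Real.rpow_inv_rpow hB h1a.ne'] at hmono
  -- multiply by `s^a > 0` and use `s^{1−a}·s^a = s`
  have hpa : 0 < s ^ a := Real.rpow_pos_of_pos hs0 _
  have hsplit : s ^ (1 - a) * s ^ a = s := by
    rw [← Real.rpow_add hs0, sub_add_cancel, Real.rpow_one]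
  have h2 : 2 * A / M₁ * s ^ a < s ^ (1 - a) * s ^ a := mul_lt_mul_of_pos_right hlt hpa
  rw [hsplit] at h2
  -- `2A/M₁ · s^a < s` ⇒ `A·s^a < M₁ s/2`
  have h3 : 2 * A * s ^ a < M₁ * s := by
    have := mul_lt_mul_of_pos_left h2 hM
    calc 2 * A * s ^ a = M₁ * (2 * A / M₁ * s ^ a) := by field_simp
      _ < M₁ * s := this
  linarith

/-- **THE BARRIER, QUANTITATIVE FORM**: beyond `barrierScale M₁ tol s₁ a A` (with `A = posConstSum C`) the family supplies STRICTLY LESS than the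
requirement. [folklore] -/
theorem suppliedMass_lt_requirement_of_barrierScale_le {f : Fin k → ℝ → ℝ} {α C : Fin k → ℝ} {s₁ a M₁ tol s : ℝ}
    (hM : 0 < M₁) (ha : a < 1) (hα : ∀ i, α i ≤ a) (hf : ∀ i, PowerBoundFrom (f i) (α i) (C i) s₁)
    (hs : barrierScale M₁ tol s₁ a (posConstSum C) ≤ s) :
    suppliedMass f s < requirement M₁ tol s := by
  obtain ⟨hs₁, h1, htol, hA⟩ := barrierScale_le_iff_aux hs
  have henv := suppliedMass_le_posConstSum_mul_rpow hf hα hs₁.le h1.le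
  have hhalf := posConst_mul_rpow_lt_half (posConstSum_nonneg C) hM ha h1.le hA
  -- `tol < M₁ s / 2` from `2 tol / M₁ < s`
  have htol' : tol < M₁ * s / 2 := by
    have := mul_lt_mul_of_pos_left htol hM
    have h' : M₁ * (2 * tol / M₁) = 2 * tol := by field_simp
    rw [h'] at this
    linarith
  unfold requirement
  linarith

/-- **No closing beyond the threshold** (negated `ClosedBy`). [folklore] -/
theorem not_closedBy_of_barrierScale_le {f : Fin k → ℝ → ℝ} {α C : Fin k → ℝ} {s₁ a M₁ tol s : ℝ}
    (hM : 0 < M₁) (ha : a < 1) (hα : ∀ i, α i ≤ a) (hf : ∀ i, PowerBoundFrom (f i) (α i) (C i) s₁)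
    (hs : barrierScale M₁ tol s₁ a (posConstSum C) ≤ s) :
    ¬ ClosedBy f M₁ tol s :=
  fun h => absurd (lt_of_le_of_lt h (suppliedMass_lt_requirement_of_barrierScale_le hM ha hα hf hs)) (lt_irrefl _)

/-- **`NeverClosedFrom` at the explicit threshold.** [folklore] -/
theorem neverClosedFrom_barrierScale {f : Fin k → ℝ → ℝ} {α C : Fin k → ℝ} {s₁ a M₁ tol : ℝ}
    (hM : 0 < M₁) (ha : a < 1) (hα : ∀ i, α i ≤ a) (hf : ∀ i, PowerBoundFrom (f i) (α i) (C i) s₁) :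
    NeverClosedFrom f M₁ tol (barrierScale M₁ tol s₁ a (posConstSum C)) :=
  fun _ hs => not_closedBy_of_barrierScale_le hM ha hα hf hs

/-- **THE HEIGHT-SCALING BARRIER HOLDS** (witness `s₀ = barrierScale M₁ tol s₁ a (Σ_i max(C_i,0))`). [folklore] -/
theorem barrier_holds : Barrier :=
  fun _k _f _α C s₁ a M₁ tol hM ha hα hf => ⟨barrierScale M₁ tol s₁ a (posConstSum C), neverClosedFrom_barrierScale hM ha hα hf⟩

/-- **CONDUCTOR-TYPE CASE OF RECORD (`α = 0`), SHARP**: if every object is bounded height-free by `C_i` from `s₁` on, then the family does not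
close the requirement at ANY dilation `s ≥ s₁` with `s > (Σ_i C_i + tol)/M₁` — FINAL (1)(e)'s crossing law «`s× ≤ (C + tol)/M₁`» as an
inequality. [folklore] -/
theorem not_closedBy_of_heightFree {f : Fin k → ℝ → ℝ} {C : Fin k → ℝ} {s₁ M₁ tol s : ℝ} (hM : 0 < M₁)
    (hf : ∀ i, ∀ s', s₁ ≤ s' → f i s' ≤ C i) (hs₁ : s₁ ≤ s) (hs : (∑ i, C i + tol) / M₁ < s) :
    ¬ ClosedBy f M₁ tol s := by
  intro h
  have hsum : suppliedMass f s ≤ ∑ i, C i := Finset.sum_le_sum fun i _ => hf i s hs₁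
  have hlt : ∑ i, C i + tol < M₁ * s := by
    have := mul_lt_mul_of_pos_left hs hM
    have h' : M₁ * ((∑ i, C i + tol) / M₁) = ∑ i, C i + tol := by field_simp
    rwa [h'] at this
  have := le_trans h hsum
  unfold requirement at this
  linarith

/-- A height-free bound IS a power bound with exponent `0` (so the conductor-type classes enter `Barrier` with `α = 0`, `a = 0`).
[folklore] -/
theorem powerBoundFrom_zero_of_heightFree {f : ℝ → ℝ} {C s₁ : ℝ} (hf : ∀ s, s₁ ≤ s → f s ≤ C) :
    PowerBoundFrom f 0 C s₁ := by
  intro s hs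
  simpa [Real.rpow_zero] using hf s hs

/-- **RECOVERED-FRACTION READING, exponent `−1`**: a height-free family with positive-part constant `A = Σ max(C_i,0)` recovers at most the
fraction `(2A/M₁)·s⁻¹` of the requirement at every `s ≥ s₁` with `s > 0` and `2·tol ≤ M₁·s` (then `T(s) ≥ M₁·s/2 > 0`). [folklore] -/
theorem recoveredFraction_le_of_heightFree {f : Fin k → ℝ → ℝ} {C : Fin k → ℝ} {s₁ M₁ tol s : ℝ} (hM : 0 < M₁)
    (hf : ∀ i, ∀ s', s₁ ≤ s' → f i s' ≤ C i) (hs₁ : s₁ ≤ s) (hs0 : 0 < s) (htol : 2 * tol ≤ M₁ * s) :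
    recoveredFraction f M₁ tol s ≤ 2 * posConstSum C / M₁ * s⁻¹ := by
  have hT : M₁ * s / 2 ≤ requirement M₁ tol s := by unfold requirement; linarith
  have hTpos : 0 < requirement M₁ tol s := lt_of_lt_of_le (by positivity) hT
  have hsum : suppliedMass f s ≤ posConstSum C :=
    Finset.sum_le_sum fun i _ => le_trans (hf i s hs₁) (le_max_left _ _)
  unfold recoveredFraction
  rw [div_le_iff₀ hTpos]
  calc suppliedMass f s ≤ posConstSum C := hsum
    _ = 2 * posConstSum C / M₁ * s⁻¹ * (M₁ * s / 2) := by field_simp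
    _ ≤ 2 * posConstSum C / M₁ * s⁻¹ * requirement M₁ tol s :=
        mul_le_mul_of_nonneg_left hT (by have := posConstSum_nonneg C; positivity)

/-- **SOCKET for a typed height family**: any height-indexed statement `Φ s` that implies «requirement ≤ supplied mass» at `s` (e.g. the typed
`Statement` at the dilated setting `P_s` via p480491 `statement_iff_signedRemainder_nonpos`, with the supplied mass split over the certified
objects) FAILS at every `s ≥ barrierScale …` once the objects obey mass laws with exponents `≤ a < 1`. [claim: Mochizuki2012, status: disputed] -/
theorem not_holds_from_barrier {Φ : ℝ → Prop} {f : Fin k → ℝ → ℝ} {α C : Fin k → ℝ} {s₁ a M₁ tol : ℝ}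
    (hM : 0 < M₁) (ha : a < 1) (hα : ∀ i, α i ≤ a) (hf : ∀ i, PowerBoundFrom (f i) (α i) (C i) s₁)
    (hΦ : ∀ s, Φ s → ClosedBy f M₁ tol s) :
    ∀ s, barrierScale M₁ tol s₁ a (posConstSum C) ≤ s → ¬ Φ s :=
  fun s hs hφ => not_closedBy_of_barrierScale_le hM ha hα hf hs (hΦ s hφ)

/-! ## §2b. Bridge from RECOVERED-FRACTION profiles (abc-iut-rh2-T-1's `ExponentAtMost g α C`, fraction of `M(s) = M₁·s`) to mass laws -/

/-- **Fraction profile ⇒ mass law**: if an object's recovered FRACTION of the total mass `M(s) = M₁·s` obeys `g(s) ≤ C·s^α` for `s ≥ 1`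
(abc-iut-rh2-T-1's `ExponentAtMost g α C`, unfolded), then its MASS `g(s)·(M₁·s)` obeys `PowerBoundFrom _ (α+1) (C·M₁) 1` — fraction exponent `α`
is mass exponent `α + 1`. [folklore] -/
theorem powerBoundFrom_mass_of_fraction {g : ℝ → ℝ} {α C M₁ : ℝ} (hM : 0 ≤ M₁)
    (hg : ∀ s : ℝ, 1 ≤ s → g s ≤ C * s ^ α) :
    PowerBoundFrom (fun s => g s * (M₁ * s)) (α + 1) (C * M₁) 1 := by
  intro s hs
  have hs0 : 0 < s := lt_of_lt_of_le zero_lt_one hs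
  have hMs : 0 ≤ M₁ * s := mul_nonneg hM hs0.le
  calc g s * (M₁ * s) ≤ C * s ^ α * (M₁ * s) := mul_le_mul_of_nonneg_right (hg s hs) hMs
    _ = C * M₁ * s ^ (α + 1) := by rw [Real.rpow_add_one hs0.ne']; ring

/-- **THE BARRIER IN FRACTION CURRENCY** (the desk's / abc-iut-rh2-T-1's reading): a finite family of objects whose recovered-fraction profiles
`g_i` (fractions of `M(s) = M₁·s`) satisfy `g_i(s) ≤ C_i·s^{α_i}` for `s ≥ 1` with `α_i ≤ a < 0` — «every class has exponent `< 0`» — never closes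
the requirement `M₁·s − tol` from the explicit dilation `barrierScale M₁ tol 1 (a+1) (Σ_i max(C_i·M₁, 0))` on. [folklore] -/
theorem neverClosedFrom_of_fractionExponents_lt_zero {g : Fin k → ℝ → ℝ} {α C : Fin k → ℝ} {a M₁ tol : ℝ}
    (hM : 0 < M₁) (ha : a < 0) (hα : ∀ i, α i ≤ a) (hg : ∀ i, ∀ s : ℝ, 1 ≤ s → g i s ≤ C i * s ^ α i) :
    NeverClosedFrom (fun i s => g i s * (M₁ * s)) M₁ tol
      (barrierScale M₁ tol 1 (a + 1) (posConstSum fun i => C i * M₁)) :=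
  neverClosedFrom_barrierScale (α := fun i => α i + 1) hM (by linarith) (fun i => by simpa using hα i)
    fun i => powerBoundFrom_mass_of_fraction hM.le (hg i)

/-! ## §3. Satisfiability witness on the bed: the worked place FREY `p = 7`, `l = 107`, dilated `m_q ↦ 210·s` -/

/-- **`M(s) = 10 707 060·s`**: the total trivial mass of the worked place is LINEAR in the dilation (`t_j(s) = (j²−1)·210·s`; the slope is
p490925 `frey7_l107_totalMass` BY NAME). [folklore] -/
theorem frey7_l107_mass_dilate (s : ℤ) :
    ∑ k ∈ range 53, (((1 + (k : ℤ)) ^ 2 - 1) * (210 * s)) = 10707060 * s := by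
  have h := Summit.ABC.IUTFork.Repair.RH.ToptKnapsack.frey7_l107_totalMass
  calc ∑ k ∈ range 53, (((1 + (k : ℤ)) ^ 2 - 1) * (210 * s))
        = (∑ k ∈ range 53, (((1 + (k : ℤ)) ^ 2 - 1) * 210)) * s := by
          rw [Finset.sum_mul]; exact Finset.sum_congr rfl fun k _ => by ring
    _ = 10707060 * s := by rw [h]

/-- The height-free price envelope of the place: `Σ_{j=1}^{53} (j·1604 + (j+1)·4740 + 1604) = 9 414 496`. [folklore] -/
theorem frey7_l107_priceEnvelope :
    ∑ k ∈ range 53, ((1 + (k : ℤ)) * 1604 + (1 + (k : ℤ) + 1) * (268 - (-4472)) + 1604) = 9414496 := by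
  decide

/-- **CONDUCTOR-TYPE IN KERNEL at the worked place**: the exact price `price_j(s) = j·1604 + (j+1)·(268 + 4472) + ((j²·210·s − j·1604 − (j+1)·268) mod 1605)`
(p484618 / p488873 currency, `m_q ↦ 210·s`) depends on the dilation ONLY through a residue `< 1605`, so `Π(s) ≤ 9 414 496` at EVERY `s : ℤ` —
no height term. [folklore] -/
theorem frey7_l107_price_dilate_le (s : ℤ) :
    ∑ k ∈ range 53, ((1 + (k : ℤ)) * 1604 + (1 + (k : ℤ) + 1) * (268 - (-4472)) +
        ((1 + (k : ℤ)) ^ 2 * (210 * s) - (1 + (k : ℤ)) * 1604 - (1 + (k : ℤ) + 1) * 268) % 1605) ≤ 9414496 := by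
  rw [← frey7_l107_priceEnvelope]
  refine Finset.sum_le_sum fun k _ => ?_
  have hlt : ((1 + (k : ℤ)) ^ 2 * (210 * s) - (1 + (k : ℤ)) * 1604 - (1 + (k : ℤ) + 1) * 268) % 1605 < 1605 :=
    Int.emod_lt_of_pos _ (by norm_num)
  omega

/-- **`Π(s) < M(s)` for every dilation `s ≥ 1`** at the worked place: the EX/across-netting envelope `min(M, Π)` of the place (pv-2 `kept_le_surplusValue`:
every scheme keeps `≤ mass(σ) + C_σ ≤ Π`) stays below the tol-free requirement at every height on the ray — recovered fraction `≤ 9 414 496/(10 707 060·s)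
= 0.8793/s`. [folklore] -/
theorem frey7_l107_price_lt_mass_dilate (s : ℤ) (hs : 1 ≤ s) :
    ∑ k ∈ range 53, ((1 + (k : ℤ)) * 1604 + (1 + (k : ℤ) + 1) * (268 - (-4472)) +
        ((1 + (k : ℤ)) ^ 2 * (210 * s) - (1 + (k : ℤ)) * 1604 - (1 + (k : ℤ) + 1) * 268) % 1605)
      < ∑ k ∈ range 53, (((1 + (k : ℤ)) ^ 2 - 1) * (210 * s)) := by
  rw [frey7_l107_mass_dilate]
  have h := frey7_l107_price_dilate_le s
  omega

/-- The one-object family «height-free netting envelope of the worked place»: `f₀(s) = 9 414 496` (cell units). [folklore] -/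
def frey7_l107_envelope : Fin 1 → ℝ → ℝ :=
  fun _ _ => 9414496

/-- The envelope obeys the mass law with exponent `0`, constant `9 414 496`, onset `1`. [folklore] -/
theorem frey7_l107_envelope_powerBound (i : Fin 1) : PowerBoundFrom (frey7_l107_envelope i) 0 9414496 1 := by
  intro s _
  simp [frey7_l107_envelope, Real.rpow_zero]

/-- **At the worked place the barrier's conclusion holds from `s = 1` on** (tol-free requirement of slope `10 707 060`): the envelope family never closes.
[folklore] -/
theorem frey7_l107_envelope_neverClosed : NeverClosedFrom frey7_l107_envelope 10707060 0 1 := by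
  intro s hs h
  rw [closedBy_iff] at h
  simp [frey7_l107_envelope] at h
  linarith

/-- **THE BARRIER IS NOT VACUOUS — satisfiability witness on the bed**: the hypotheses of `Barrier` are met by a NON-EMPTY family built from the
kernel numerals of the worked place (`k = 1`, `M₁ = 10 707 060 > 0`, `tol = 0`, `a = 0 < 1`, `α = 0`, `C = 9 414 496`, `s₁ = 1`). [folklore] -/
theorem barrier_antecedent_inhabited :
    ∃ (k : ℕ) (f : Fin k → ℝ → ℝ) (α C : Fin k → ℝ) (s₁ a M₁ tol : ℝ),
      0 < k ∧ 0 < M₁ ∧ 0 ≤ tol ∧ a < 1 ∧ (∀ i, α i ≤ a) ∧ (∀ i, PowerBoundFrom (f i) (α i) (C i) s₁) :=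
  ⟨1, frey7_l107_envelope, fun _ => 0, fun _ => 9414496, 1, 0, 10707060, 0, Nat.one_pos, by norm_num, le_rfl, zero_lt_one,
    fun _ => le_rfl, frey7_l107_envelope_powerBound⟩

/-- **The explicit threshold at the witness**: with `A = 9 414 496`, `M₁ = 10 707 060`, `tol = 0`, `s₁ = 1`, `a = 0` the closed-form threshold is
`barrierScale = max(1, 1, 0, 2A/M₁) + 1 = 2·9414496/10707060 + 1 < 2.76` — so the general theorem bars closing from `s ≥ 2.76` at this place
(the sharp conductor-type form bars it from `s > A/M₁ = 0.8793`, i.e. at every `s ≥ 1`). [folklore] -/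
theorem frey7_l107_barrierScale_lt :
    barrierScale 10707060 0 1 0 (posConstSum fun _ : Fin 1 => (9414496 : ℝ)) < 2.76 := by
  unfold barrierScale posConstSum
  norm_num

end Summit.ABC.IUTFork.Repair.RH.HeightScalingBarrier

end
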